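import Literature.AlgebraicGeometry.Motives.HodgeLieTimesGluedBlocks
import Literature.AlgebraicGeometry.HodgeTheory.TimesGluedBlocksProductSpan
import Summits.HodgeConjecture.CorCM.MumfordTateRankTimesLowGeneric
import HarnessLib

/-!
# The Mumford–Tate rank of `A × S` for `S` with REAL MULTIPLICATION of relative dimension one or QUATERNIONIC MULTIPLICATION of minimal
# dimension and ANY `A` with `Hom(A, S) = 0`: `t(A × S) + 1 = t(A) + t(S)` (Moonen–Zarhin 1999 Lemma (3.4) with (2.2))

COR-CM (cell `pub-hodgecm2`, seat `b27` gen 47, count-neutral Mumford–Tate-rank ladder; theorems only, no definition, no named fact;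
UNCONDITIONAL — nothing here uses or asserts HC_CM).  `t(X) := dim MT(H¹X) = dim Lie Hg(H¹X) + 1`.

Moonen–Zarhin 1999 Lemma (3.4) («`hg(X₂)` `ℚ`-simple of non-compact type with `V_{X₂}` its only length-one representation, `Hom(X₂, X₁) = 0`
⟹ `Hg(X₁ × X₂) = Hg(X₁) × Hg(X₂)`») is in the tree, for a second factor whose admissible algebras are GLUED `𝔰𝔩₂`-BLOCKS, as the Lie
statement `corner_mem_and_finrank_hodgeLie_eq_add_of_gluedBlocks_summand` (`Motives/HodgeLieTimesGluedBlocks`: `dim 𝔥(H₁ ⊕ H₂) =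
dim 𝔥(H₁) + dim 𝔥(H₂)`), and the glued-block data are DISCHARGED by the tree's bridges (cell `pub-hodge-ring2`,
`HodgeTheory/TimesGluedBlocksProductSpan` §3–§5): for `S` of Murty type with `m = 1` — a totally real number field `K`, `φ : K → End⁰S` its
own commutant, `dim S = [K:ℚ]` (Moonen–Zarhin (2.2) Type I(2) for surfaces: `Hg(S) = R_{F/ℚ} SL_{2,F}`) — on the joint eigenspaces
`V_κ` (`exists_glued_adapted_blockBasis_of_isMurtyTypeWith_one`, `exists_mem_jointEigenspace_baseChange_ne_zero`), and for SIMPLE `S` with a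
real splitting `ℝ ⊗ End⁰S ≃ ∏_ι M₂(ℝ)`, `dim S = 2|ι|` (Type II(1) for surfaces: `Hg(S) = U_{D^opp}`) on the matrix-unit blocks
(`exists_glued_adapted_blockBasis_of_realSplitting`).  HERE, for the ladder:

* §1 `finrank_hodgeLie_hodge_one_prod_eq_add_of_isMurtyTypeWith_one`, `…_of_isSimple_realSplitting` — `dim Lie Hg(H¹(A × S)) =
  dim Lie Hg(H¹A) + dim Lie Hg(H¹S)` (`Hom(A, S) = 0`, `A` ARBITRARY);
* §2 **`mtRank_hodge_one_add_one_eq_add_of_isIsogenous_prod_isMurtyTypeWith_one`**, **`…_prod_isSimple_quaternion`** — `t(X) + 1 = t(A) + t(S)`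
  for every `X ∼ A × S`;
* the CELLS (surfaces of types I(2), II(1); Ribet's class `End⁰S` totally real of degree `dim S`; `RM × RM′ = 13`, cubic-field threefolds
  `t(A × T) = t(A) + 9`, `T × T′ = 19`) are read off in `CorCM/MumfordTateRankTimesRealMultiplicationCells`.

## References
* [MoonenZarhin1999LowDim] B. Moonen, Yu. G. Zarhin, *Hodge classes on abelian varieties of low dimension*, Math. Ann. 315 (1999),
  §2 (2.2), §3 (3.1), Lemma (3.4), §5 (5.4)–(5.5) [corpus: paper:arxiv-math_9901113 pp. 5–7, 9]. [cite: MoonenZarhin1999LowDim, §3 Lemma (3.4)]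
* [Hazama1983] F. Hazama, Tôhoku Math. J. 35 (1983), §3 pp. 305–306. [cite: Hazama1983, §3 (pp. 305–306)]
* [Murty1988] V. Kumar Murty, Proc. AMS 104 (1988), Thm. 2 (p. 67). [cite: Murty1988, Thm. 2 (p. 67)]
* [DeligneMilne1982Tannakian] P. Deligne, J. S. Milne, LNM 900 (1982), §6 Thm. 6.20. [cite: DeligneMilne1982Tannakian, §6 Thm. 6.20]
-/

noncomputable section

open scoped TensorProduct
open CategoryTheory CategoryTheory.Limits Module NumberField

namespace Summit.HodgeConjecture.CorCM

open Literature.AlgebraicGeometry.Motives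
open Literature.AlgebraicGeometry.Motives.AbelianVariety
open Literature.AlgebraicGeometry.Motives.HodgeStructure
open Literature.AlgebraicGeometry.HodgeTheory
open Literature.AlgebraicGeometry.ComplexMultiplication
open Literature.AlgebraicGeometry.Milne1999 (IsOfCMType)
open Literature.RepresentationTheory.GeneralLinear
open Literature.NumberTheory.Automorphic (IsQuaternionAlgebra)

variable [HodgeTensorFacts.{0, 0}] {X : AbelianVariety ℂ} {n : ℕ}

/-! ## §1 `dim Lie Hg(H¹(A × S)) = dim Lie Hg(H¹A) + dim Lie Hg(H¹S)` from glued-block data on `H¹(S) ⊗ ℂ` -/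

/-- **The glued-blocks row for `Lie Hg`: `dim Lie Hg(H¹(A × S)) = dim Lie Hg(H¹A) + dim Lie Hg(H¹S)`** when `H¹(S) ⊗ ℂ = ⊕_k T_k` carries
glued-block data ((BLOCKS) `hTE`, (GLUED) `hS`, (QS) `hqs` — verbatim the hypotheses of the tree's
`hodgeClassesProductSpan_of_avSlots_of_gluedBlocks`) and `Hom(A, S) = 0` (Moonen–Zarhin Lemma (3.4): `Hg(A × S) = Hg(A) × Hg(S)`; the bicone
`fst, snd, prodLift 𝟙 0, prodLift 0 𝟙` presents `H¹(A × S) = H¹A ⊕ H¹S`; Riemann turns `Hom(A, S) = 0` into `Hom_Hdg(H¹S, H¹A) = 0`).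
[cite: MoonenZarhin1999LowDim, §3 Lemma (3.4)] [cite: DeligneMilne1982Tannakian, §6 Thm. 6.20] -/
theorem finrank_hodgeLie_hodge_one_prod_eq_add_of_gluedBlocks {A S : AbelianVariety ℂ} {κ : Type} [Fintype κ] [DecidableEq κ] [Nonempty κ]
    {T : κ → Submodule ℂ (ℂ ⊗[ℚ] bettiCohomology S.X 1)} (hint : DirectSum.IsInternal T)
    (hTE : ∀ (hHD : exists_isReal_hodgeModel) (hI : hodgePQ_independent_of_hodgeModel) (Y : Module.End ℚ (bettiCohomology S.X 1)),
      (∀ a : (BettiUniverse.hodge hHD (AbelianVariety.isSmoothProjective_holds (A := S)) 1).endAlg,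
        Y * (a : Module.End ℚ (bettiCohomology S.X 1)) = (a : Module.End ℚ (bettiCohomology S.X 1)) * Y) →
      ∀ k, Set.MapsTo (Y.baseChange ℂ) (T k) (T k))
    (hS : ∀ (hHD : exists_isReal_hodgeModel) (hI : hodgePQ_independent_of_hodgeModel)
      (ψ : (BettiUniverse.hodge hHD (AbelianVariety.isSmoothProjective_holds (A := S)) 1).Polarization)
      {Θ : Module.End ℂ (ℂ ⊗[ℚ] bettiCohomology S.X 1)},
      (∀ p, ∀ x ∈ (BettiUniverse.hodge hHD (AbelianVariety.isSmoothProjective_holds (A := S)) 1).piece p (((1 : ℕ) : ℤ) - p),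
        Θ x = ((2 * p - ((1 : ℕ) : ℤ) : ℤ) : ℂ) • x) →
      ∃ (cls : κ → κ) (b' : ∀ k, Module.Basis (Fin 2) ℂ (T k)),
        (∀ k, (b' k 0 : ℂ ⊗[ℚ] bettiCohomology S.X 1) ∈ (BettiUniverse.hodge hHD (AbelianVariety.isSmoothProjective_holds (A := S)) 1).piece 1 0) ∧
        (∀ k, (b' k 1 : ℂ ⊗[ℚ] bettiCohomology S.X 1) ∈ (BettiUniverse.hodge hHD (AbelianVariety.isSmoothProjective_holds (A := S)) 1).piece 0 1) ∧
        (∀ k, cls (cls k) = cls k) ∧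
        ∀ 𝔤 : Submodule ℚ (Module.End ℚ (bettiCohomology S.X 1)),
          (∀ Y ∈ 𝔤, ∀ Y' ∈ 𝔤, Y * Y' - Y' * Y ∈ 𝔤) → Θ ∈ spanC 𝔤 →
          (∀ Y ∈ 𝔤, ∀ a : (BettiUniverse.hodge hHD (AbelianVariety.isSmoothProjective_holds (A := S)) 1).endAlg,
            Y * (a : Module.End ℚ (bettiCohomology S.X 1)) = (a : Module.End ℚ (bettiCohomology S.X 1)) * Y) →
          (∀ Y ∈ 𝔤, ∀ v w, ψ.form (Y v) w + ψ.form v (Y w) = 0) →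
          (∀ Y ∈ spanC 𝔤, ∀ k, (RealPlaces.blockMat hint b' Y k).trace = 0) ∧
          (∀ Y ∈ spanC 𝔤, ∀ k k', cls k = cls k' → RealPlaces.blockMat hint b' Y k = RealPlaces.blockMat hint b' Y k') ∧
          (∀ (k₀ : κ) (N : Matrix (Fin 2) (Fin 2) ℂ), N.trace = 0 →
            RealPlaces.assemble hint b' (fun k => if cls k = cls k₀ then N else 0) ∈ spanC 𝔤))
    (hqs : ∀ (hHD : exists_isReal_hodgeModel) (hI : hodgePQ_independent_of_hodgeModel) (Y : Module.End ℚ (bettiCohomology S.X 1)),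
      (∀ a : (BettiUniverse.hodge hHD (AbelianVariety.isSmoothProjective_holds (A := S)) 1).endAlg,
        Y * (a : Module.End ℚ (bettiCohomology S.X 1)) = (a : Module.End ℚ (bettiCohomology S.X 1)) * Y) →
      Y ≠ 0 → ∀ k, ∃ x ∈ T k, Y.baseChange ℂ x ≠ 0)
    (hAS : ∀ u : A ⟶ S, u = 0) {m : ℕ} (hP : IsSmoothProjective m (A.prod S).X) :
    haveI := BettiUniverse.finite hP 1
    haveI := BettiUniverse.finite (AbelianVariety.isSmoothProjective_holds (A := A)) 1
    haveI := BettiUniverse.finite (AbelianVariety.isSmoothProjective_holds (A := S)) 1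
    Module.finrank ℚ (BettiUniverse.hodge exists_isReal_hodgeModel_holds hP 1).hodgeLie =
      Module.finrank ℚ (BettiUniverse.hodge exists_isReal_hodgeModel_holds (AbelianVariety.isSmoothProjective_holds (A := A)) 1).hodgeLie +
        Module.finrank ℚ (BettiUniverse.hodge exists_isReal_hodgeModel_holds (AbelianVariety.isSmoothProjective_holds (A := S)) 1).hodgeLie := by
  classical
  have hA : IsSmoothProjective A.dim A.X := AbelianVariety.isSmoothProjective_holds
  have hSsp : IsSmoothProjective S.dim S.X := AbelianVariety.isSmoothProjective_holds
  haveI := BettiUniverse.finite hP 1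
  haveI := BettiUniverse.finite hA 1
  haveI := BettiUniverse.finite hSsp 1
  have hHD : exists_isReal_hodgeModel := exists_isReal_hodgeModel_holds
  have hI : hodgePQ_independent_of_hodgeModel := hodgePQ_independent_of_hodgeModel_holds
  -- the bicone of `H¹`
  let ι₁ := BettiUniverse.pullHodgeHom hHD hI hP hA (fst A S).hom.hom.hom 1
  let π₁ := BettiUniverse.pullHodgeHom hHD hI hA hP (prodLift (𝟙 A) (0 : A ⟶ S)).hom.hom.hom 1
  let ι₂ := BettiUniverse.pullHodgeHom hHD hI hP hSsp (snd A S).hom.hom.hom 1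
  let π₂ := BettiUniverse.pullHodgeHom hHD hI hSsp hP (prodLift (0 : S ⟶ A) (𝟙 S)).hom.hom.hom 1
  have hsumP : fst A S ≫ prodLift (𝟙 A) (0 : A ⟶ S) + snd A S ≫ prodLift (0 : S ⟶ A) (𝟙 S) = 𝟙 _ := by
    refine prod_hom_ext ?_ ?_
    · rw [Preadditive.add_comp, Category.assoc, Category.assoc, prodLift_fst, prodLift_fst, Category.comp_id,
        comp_zero, add_zero, Category.id_comp]
    · rw [Preadditive.add_comp, Category.assoc, Category.assoc, prodLift_snd, prodLift_snd, Category.comp_id,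
        comp_zero, zero_add, Category.id_comp]
  have hπι₁ : ∀ v, π₁.toLinearMap (ι₁.toLinearMap v) = v := fun v => pull_pull_eq_self_of_comp_eq_id (prodLift_fst _ _) v
  have hπι₂ : ∀ v, π₂.toLinearMap (ι₂.toLinearMap v) = v := fun v => pull_pull_eq_self_of_comp_eq_id (prodLift_snd _ _) v
  have hsum : ∀ v, ι₁.toLinearMap (π₁.toLinearMap v) + ι₂.toLinearMap (π₂.toLinearMap v) = v := fun v =>
    pull_pull_add_pull_pull_eq_self _ _ _ _ hsumP v
  obtain ⟨ψ₁⟩ := BettiUniverse.hodge_isPolarizable hHD hA 1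
  obtain ⟨ψ₂⟩ := BettiUniverse.hodge_isPolarizable hHD hSsp 1
  -- `Hom(A, S) = 0` in piece form
  have hHom : ∀ f : bettiCohomology S.X 1 →ₗ[ℚ] bettiCohomology A.X 1,
      (∀ r : ℤ, ∀ x ∈ (BettiUniverse.hodge hHD hSsp 1).piece r (((1 : ℕ) : ℤ) - r),
        f.baseChange ℂ x ∈ (BettiUniverse.hodge hHD hA 1).piece r (((1 : ℕ) : ℤ) - r)) → f = 0 := by
    intro f hf
    refine forall_isHodgeMorphismOne_eq_zero_of_forall_hom_eq_zero hAS f ⟨fun x hx => ?_, fun x hx => ?_⟩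
    · have hx' := (BettiUniverse.mem_hodge_piece_iff hHD hI hSsp (k := 1) (p := 1) (q := 0) rfl _).2 hx
      have e : (((1 : ℕ) : ℤ) - 1) = 0 := by norm_num
      have h := hf 1 x (by rw [e]; exact hx')
      rw [e] at h
      exact (BettiUniverse.mem_hodge_piece_iff hHD hI hA (k := 1) (p := 1) (q := 0) rfl _).1 h
    · have hx' := (BettiUniverse.mem_hodge_piece_iff hHD hI hSsp (k := 1) (p := 0) (q := 1) rfl _).2 hx
      have e : (((1 : ℕ) : ℤ) - 0) = 1 := by norm_num
      have h := hf 0 x (by rw [e]; exact hx')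
      rw [e] at h
      exact (BettiUniverse.mem_hodge_piece_iff hHD hI hA (k := 1) (p := 0) (q := 1) rfl _).1 h
  have heff₁ := BettiUniverse.hodge_isEffective hHD hA 1
  have heff₂ := BettiUniverse.hodge_isEffective hHD hSsp 1
  -- the glued-block data for a Hodge operator of `H¹(S)`
  obtain ⟨Θ₂, hΘ₂⟩ := exists_hodgeTheta (BettiUniverse.hodge hHD hSsp 1)
  obtain ⟨cls, b₂, hb0, hb1, hcls, hglued⟩ := hS hHD hI ψ₂ hΘ₂
  have e1 : (((1 : ℕ) : ℤ) - 1) = 0 := by norm_num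
  have e0 : (((1 : ℕ) : ℤ) - 0) = 1 := by norm_num
  exact (corner_mem_and_finrank_hodgeLie_eq_add_of_gluedBlocks_summand ι₁ π₁ ι₂ π₂ hπι₁ hπι₂ hsum Nat.cast_one heff₁ heff₂ ψ₁ ψ₂ hΘ₂
    hint b₂ (fun k => by rw [e1]; exact hb0 k) (fun k => by rw [e0]; exact hb1 k) cls hcls (fun Y hY k => hTE hHD hI Y hY k) hglued
    (fun Y hY _ hY0 k => hqs hHD hI Y hY hY0 k) hHom).2

/-- **The Murty row: `dim Lie Hg(H¹(A × S)) = dim Lie Hg(H¹A) + dim Lie Hg(H¹S)` for `S` of Murty type with `m = 1`** (a totally real number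
field `K`, `φ : K →+* End⁰S` its own commutant, `dim S = [K:ℚ]` — e.g. a simple abelian surface with real multiplication) and ANY `A` with
`Hom(A, S) = 0`: the glued data on the joint eigenspaces `V_κ` (`exists_glued_adapted_blockBasis_of_isMurtyTypeWith_one`,
`mapsTo_jointEigenspace_of_forall_commute`, `exists_mem_jointEigenspace_baseChange_ne_zero`).  Moonen–Zarhin (2.2) Type I(2) with Lemma (3.4):
`Hg(A × S) = Hg(A) × R_{F/ℚ} SL_{2,F}`. [cite: MoonenZarhin1999LowDim, §2 (2.2) and §3 Lemma (3.4)] [cite: Murty1988, Thm. 2 (p. 67)]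
[cite: Hazama1983, §3 (pp. 305–306)] -/
theorem finrank_hodgeLie_hodge_one_prod_eq_add_of_isMurtyTypeWith_one {A S : AbelianVariety ℂ} {K : Type} [Field K] [NumberField K]
    {φ : K →+* S.endAlgebra} (hSm : IsMurtyTypeWith S K φ 1) (hAS : ∀ u : A ⟶ S, u = 0) {m : ℕ} (hP : IsSmoothProjective m (A.prod S).X) :
    haveI := BettiUniverse.finite hP 1
    haveI := BettiUniverse.finite (AbelianVariety.isSmoothProjective_holds (A := A)) 1
    haveI := BettiUniverse.finite (AbelianVariety.isSmoothProjective_holds (A := S)) 1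
    Module.finrank ℚ (BettiUniverse.hodge exists_isReal_hodgeModel_holds hP 1).hodgeLie =
      Module.finrank ℚ (BettiUniverse.hodge exists_isReal_hodgeModel_holds (AbelianVariety.isSmoothProjective_holds (A := A)) 1).hodgeLie +
        Module.finrank ℚ (BettiUniverse.hodge exists_isReal_hodgeModel_holds (AbelianVariety.isSmoothProjective_holds (A := S)) 1).hodgeLie := by
  classical
  haveI : Nonempty (K →+* ℂ) := Fintype.card_pos_iff.1 (by rw [NumberField.Embeddings.card]; exact Module.finrank_pos)
  have hHD₀ : exists_isReal_hodgeModel := exists_isReal_hodgeModel_holds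
  have hI₀ : hodgePQ_independent_of_hodgeModel := hodgePQ_independent_of_hodgeModel_holds
  exact finrank_hodgeLie_hodge_one_prod_eq_add_of_gluedBlocks (isInternal_jointEigenspace φ hHD₀ hI₀)
    (fun hHD hI Y hY k => mapsTo_jointEigenspace_of_forall_commute φ hHD hI hY k)
    (@fun hHD hI ψ Θ hΘ => exists_glued_adapted_blockBasis_of_isMurtyTypeWith_one φ hSm hHD hI ψ hΘ)
    (fun hHD hI Y _ hY0 k => exists_mem_jointEigenspace_baseChange_ne_zero φ hHD hI hY0 k) hAS hP

/-- **The real-splitting row: `dim Lie Hg(H¹(A × S)) = dim Lie Hg(H¹A) + dim Lie Hg(H¹S)` for SIMPLE `S` with `ℝ ⊗ End⁰S ≃ ∏_ι M₂(ℝ)` and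
`dim S = 2|ι|`** (e.g. a simple abelian surface with quaternionic multiplication) and ANY `A` with `Hom(A, S) = 0`: glued data on the
matrix-unit blocks (`exists_glued_adapted_blockBasis_of_realSplitting`, `RealSplitting.mapsTo_block_of_forall_commute`); (QS): a non-zero rational
operator commuting with the division algebra `End⁰S` of dimension `dim_ℚ H¹S` is invertible (`AntiRep.eq_zero_or_isUnit_of_forall_commute`).
Moonen–Zarhin (2.2) Type II(1) with Lemma (3.4): `Hg(A × S) = Hg(A) × U_{D^opp}`. [cite: MoonenZarhin1999LowDim, §2 (2.2) and §3 Lemma (3.4)]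
[cite: BanaszakGajdaKrason2006, (7.22) and Thm. 7.34] -/
theorem finrank_hodgeLie_hodge_one_prod_eq_add_of_isSimple_realSplitting {A S : AbelianVariety ℂ} {ι : Type} [Fintype ι] [DecidableEq ι]
    [Nonempty ι] (hSs : S.IsSimple) (Φ : ℝ ⊗[ℚ] S.endAlgebra ≃ₐ[ℝ] (ι → Matrix (Fin 2) (Fin 2) ℝ)) (hdim : S.dim = 2 * Fintype.card ι)
    (hAS : ∀ u : A ⟶ S, u = 0) {m : ℕ} (hP : IsSmoothProjective m (A.prod S).X) :
    haveI := BettiUniverse.finite hP 1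
    haveI := BettiUniverse.finite (AbelianVariety.isSmoothProjective_holds (A := A)) 1
    haveI := BettiUniverse.finite (AbelianVariety.isSmoothProjective_holds (A := S)) 1
    Module.finrank ℚ (BettiUniverse.hodge exists_isReal_hodgeModel_holds hP 1).hodgeLie =
      Module.finrank ℚ (BettiUniverse.hodge exists_isReal_hodgeModel_holds (AbelianVariety.isSmoothProjective_holds (A := A)) 1).hodgeLie +
        Module.finrank ℚ (BettiUniverse.hodge exists_isReal_hodgeModel_holds (AbelianVariety.isSmoothProjective_holds (A := S)) 1).hodgeLie := by
  classical
  haveI : Module.Finite ℚ (bettiCohomology S.X 1) := finite_bettiCohomology_one S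
  haveI : Module.Finite ℚ S.endAlgebra := AbelianVariety.finiteDimensional_endAlgebra_holds S
  have hdiv : ∀ z : S.endAlgebra, IsUnit z ∨ z = 0 := isUnit_or_eq_zero_of_isSimple hSs
  have hdeg : Module.finrank ℚ S.endAlgebra = Module.finrank ℚ (bettiCohomology S.X 1) :=
    finrank_endAlgebra_eq_finrank_bettiCohomology_one_of_realSplitting Φ hdim
  have hV : Module.finrank ℚ (bettiCohomology S.X 1) = 2 * S.dim := finrank_bettiCohomology_one S
  haveI : Nontrivial (bettiCohomology S.X 1) := Module.nontrivial_of_finrank_pos (R := ℚ) (by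
    rw [hV, hdim]; have := Fintype.card_pos (α := ι); omega)
  refine finrank_hodgeLie_hodge_one_prod_eq_add_of_gluedBlocks (RealSplitting.isInternal_block (bettiRep S) Φ)
    (fun hHD hI Y hY k => RealSplitting.mapsTo_block_of_forall_commute (bettiRep S) Φ
      (BettiUniverse.hodge hHD (AbelianVariety.isSmoothProjective_holds (A := S)) 1) (Literature.AlgebraicGeometry.HodgeTheory.unop_bettiRep_mem_endAlg hHD hI) hY k)
    (@fun hHD hI ψ Θ hΘ => exists_glued_adapted_blockBasis_of_realSplitting hSs Φ hdim hHD hI ψ hΘ)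
    (fun hHD hI Y hY hY0 k => ?_) hAS hP
  -- (QS)
  rcases AntiRep.eq_zero_or_isUnit_of_forall_commute (bettiRep S) hdiv hdeg (fun z => hY ⟨_, Literature.AlgebraicGeometry.HodgeTheory.unop_bettiRep_mem_endAlg hHD hI z⟩) with h0 | ⟨u, hu⟩
  · exact absurd h0 hY0
  · have h2 : Module.finrank ℂ (RealSplitting.block (bettiRep S) Φ k) = 2 := RealSplitting.finrank_block (bettiRep S) Φ hdiv hdeg k
    obtain ⟨x, hx, hx0⟩ := Submodule.exists_mem_ne_zero_of_ne_bot (p := RealSplitting.block (bettiRep S) Φ k)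
      (fun hb => by have h0 := Submodule.finrank_eq_zero.2 hb; omega)
    refine ⟨x, hx, fun hYx => hx0 ?_⟩
    have hinv : (↑u⁻¹ : Module.End ℚ (bettiCohomology S.X 1)).baseChange ℂ * Y.baseChange ℂ = 1 := by
      rw [← LinearMap.baseChange_mul, ← hu, Units.inv_mul, LinearMap.baseChange_one]
    calc x = ((↑u⁻¹ : Module.End ℚ (bettiCohomology S.X 1)).baseChange ℂ * Y.baseChange ℂ) x := by rw [hinv, Module.End.one_apply]
      _ = 0 := by rw [Module.End.mul_apply, hYx, map_zero]

/-! ## §2 Mumford–Tate ranks: `t(X) + 1 = t(A) + t(S)` -/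

/-- **`t(X) + 1 = t(A) + t(S)` for every `X ∼ A × S` with `S` of Murty type with `m = 1` and `Hom(A, S) = 0`** (`0 < dim A`;
`Hg(A × S) = Hg(A) × Hg(S)` in dimensions; no hypothesis on `A`). [cite: MoonenZarhin1999LowDim, §2 (2.2) and §3 Lemma (3.4)]
[cite: Murty1988, Thm. 2 (p. 67)] -/
theorem mtRank_hodge_one_add_one_eq_add_of_isIsogenous_prod_isMurtyTypeWith_one (hX : IsSmoothProjective n X.X) {A S : AbelianVariety ℂ}
    {k l : ℕ} (hA : IsSmoothProjective k A.X) (hS : IsSmoothProjective l S.X) (hA0 : 0 < A.dim) {K : Type} [Field K] [NumberField K]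
    {φ : K →+* S.endAlgebra} (hSm : IsMurtyTypeWith S K φ 1) (hAS : ∀ u : A ⟶ S, u = 0) (hXP : IsIsogenous X (A.prod S)) :
    haveI := BettiUniverse.finite hX 1
    haveI := BettiUniverse.finite hA 1
    haveI := BettiUniverse.finite hS 1
    (BettiUniverse.hodge exists_isReal_hodgeModel_holds hX 1).mtRank + 1 =
      (BettiUniverse.hodge exists_isReal_hodgeModel_holds hA 1).mtRank + (BettiUniverse.hodge exists_isReal_hodgeModel_holds hS 1).mtRank := by
  have hk : A.dim = k := schemeDim_eq_holds hA
  subst hk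
  have hl : S.dim = l := schemeDim_eq_holds hS
  subst hl
  haveI := BettiUniverse.finite hX 1
  haveI := BettiUniverse.finite hA 1
  haveI := BettiUniverse.finite hS 1
  have hP : IsSmoothProjective (A.prod S).dim (A.prod S).X := AbelianVariety.isSmoothProjective_holds
  haveI := BettiUniverse.finite hP 1
  have hS0 : 0 < S.dim := by rw [hSm.2.2.1, mul_one]; exact Module.finrank_pos
  have h0 : 0 < X.dim := by
    obtain ⟨g, hg⟩ := hXP; rw [dim_eq_of_isIsogeny hg, dim_prod]; omega
  have h := finrank_hodgeLie_hodge_one_prod_eq_add_of_isMurtyTypeWith_one hSm hAS hP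
  rw [← finrank_hodgeLie_hodge_one_eq_of_isIsogenous hX hP hXP] at h
  rw [mtRank_hodge_one_eq_finrank_hodgeLie_add_one hX h0, mtRank_hodge_one_eq_finrank_hodgeLie_add_one hA hA0,
    mtRank_hodge_one_eq_finrank_hodgeLie_add_one hS hS0]
  omega

/-- **`t(X) + 1 = t(A) + t(S)` for every `X ∼ A × S` with `End⁰S` itself a totally real number field of degree `dim S`** (Ribet's real
multiplication of relative dimension one: the Murty packet `isMurtyTypeWith_endField` with `r = 1`) and `Hom(A, S) = 0`.
[cite: MoonenZarhin1999LowDim, §2 (2.2) and §3 Lemma (3.4)] [cite: Murty1988, Thm. 2 and p. 66] -/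
theorem mtRank_hodge_one_add_one_eq_add_of_isIsogenous_prod_isTotallyReal (hX : IsSmoothProjective n X.X) {A S : AbelianVariety ℂ}
    {k l : ℕ} (hA : IsSmoothProjective k A.X) (hS : IsSmoothProjective l S.X) (hA0 : 0 < A.dim) (hF : IsField S.endAlgebra)
    [IsTotallyReal (EndField S hF)] (hdeg : Module.finrank ℚ S.endAlgebra = S.dim) (hAS : ∀ u : A ⟶ S, u = 0)
    (hXP : IsIsogenous X (A.prod S)) :
    haveI := BettiUniverse.finite hX 1
    haveI := BettiUniverse.finite hA 1
    haveI := BettiUniverse.finite hS 1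
    (BettiUniverse.hodge exists_isReal_hodgeModel_holds hX 1).mtRank + 1 =
      (BettiUniverse.hodge exists_isReal_hodgeModel_holds hA 1).mtRank + (BettiUniverse.hodge exists_isReal_hodgeModel_holds hS 1).mtRank :=
  mtRank_hodge_one_add_one_eq_add_of_isIsogenous_prod_isMurtyTypeWith_one hX hA hS hA0
    (isMurtyTypeWith_endField S hF inferInstance (r := 1) (by rw [mul_one, hdeg]) odd_one) hAS hXP

/-- **`t(X) + 1 = t(A) + t(S)` for every `X ∼ A × S` with `S` SIMPLE, `End⁰S` a quaternion algebra over a totally real `K`, `dim S = 2[K:ℚ]`**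
(type III being impossible in that dimension, `End⁰S` is totally indefinite and really split: `isTotallyIndefinite_of_isSimple_of_dim_eq`,
`nonempty_realSplitting_of_isSimple_isTotallyIndefinite`) and `Hom(A, S) = 0`. [cite: MoonenZarhin1999LowDim, §2 (2.2) and §3 Lemma (3.4)]
[cite: BanaszakGajdaKrason2006, Thm. 7.34] -/
theorem mtRank_hodge_one_add_one_eq_add_of_isIsogenous_prod_isSimple_quaternion (hX : IsSmoothProjective n X.X) {A S : AbelianVariety ℂ}
    {k l : ℕ} (hA : IsSmoothProjective k A.X) (hS : IsSmoothProjective l S.X) (hA0 : 0 < A.dim) (hSs : S.IsSimple) {K : Type} [Field K]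
    [NumberField K] [Algebra K S.endAlgebra] [IsScalarTower ℚ K S.endAlgebra] [IsQuaternionAlgebra K S.endAlgebra] [IsTotallyReal K]
    (hdim : S.dim = 2 * Module.finrank ℚ K) (hAS : ∀ u : A ⟶ S, u = 0) (hXP : IsIsogenous X (A.prod S)) :
    haveI := BettiUniverse.finite hX 1
    haveI := BettiUniverse.finite hA 1
    haveI := BettiUniverse.finite hS 1
    (BettiUniverse.hodge exists_isReal_hodgeModel_holds hX 1).mtRank + 1 =
      (BettiUniverse.hodge exists_isReal_hodgeModel_holds hA 1).mtRank + (BettiUniverse.hodge exists_isReal_hodgeModel_holds hS 1).mtRank := by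
  classical
  have hk : A.dim = k := schemeDim_eq_holds hA
  subst hk
  have hl : S.dim = l := schemeDim_eq_holds hS
  subst hl
  haveI := BettiUniverse.finite hX 1
  haveI := BettiUniverse.finite hA 1
  haveI := BettiUniverse.finite hS 1
  have hP : IsSmoothProjective (A.prod S).dim (A.prod S).X := AbelianVariety.isSmoothProjective_holds
  haveI := BettiUniverse.finite hP 1
  have hS0 : 0 < S.dim := by rw [hdim]; have := Module.finrank_pos (R := ℚ) (M := K); omega
  have h0 : 0 < X.dim := by
    obtain ⟨g, hg⟩ := hXP; rw [dim_eq_of_isIsogeny hg, dim_prod]; omega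
  obtain ⟨Φ⟩ := nonempty_realSplitting_of_isSimple_isTotallyIndefinite hSs (AbelianVariety.isTotallyIndefinite_of_isSimple_of_dim_eq hSs hdim)
  have h := finrank_hodgeLie_hodge_one_prod_eq_add_of_isSimple_realSplitting hSs Φ
    (by rw [card_infinitePlace_eq_finrank_of_isTotallyReal K]; exact hdim) hAS hP
  rw [← finrank_hodgeLie_hodge_one_eq_of_isIsogenous hX hP hXP] at h
  rw [mtRank_hodge_one_eq_finrank_hodgeLie_add_one hX h0, mtRank_hodge_one_eq_finrank_hodgeLie_add_one hA hA0,
    mtRank_hodge_one_eq_finrank_hodgeLie_add_one hS hS0]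
  omega

end Summit.HodgeConjecture.CorCM

end
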